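import Summits.QuantumFields.YangMills.Theorems.ColdStartUniversalityShenZhuZhuTorusWilsonLoopVarianceSU2
import Summits.QuantumFields.YangMills.Theorems.ColdStartUniversalityShenZhuZhuSubGaussianSU2
import Literature.Barriers.QuantumFields.ToronPlaneAnticorrelation
import HarnessLib

/-!
# The single PLAQUETTE `Re Tr Q_p` (tree `plaquetteReTrace`) on every torus `(ℤ/L)³` of `SU(2)` lattice Yang–Mills at strong coupling: variance
# `≤ 8/(1 − 12|β'|)` (Shen–Zhu–Zhu's `Var(Re Tr Q_p) ≤ 4N/K` at `N = 2`), Gaussian concentration, sub-Gaussian mgf — uniformly in the volume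

Seat `ym-line-csu-p1` (g38), route `ColdStartUniversality` of `Summits/QuantumFields/YangMills`, helper file G15 — the `1 × 1` instances of the
torus rectangle theorems (G9, G10, G14) in the vocabulary of the tree's plaquette observable `plaquetteReTrace ρ p`
(`p : Plaquette 3 L = Site × {(i,j) : i < j}`, `Re Tr ρ(U_p)`; used by `SZZPlaquetteSusceptibilityBound`): `Re Tr Q_p = 2 · W_{1×1}`.

* `plaquetteReTrace_eq_two_mul_wilsonLoop` — `Re Tr Q_p = 2 · wilsonLoop (fundamentalRep (Fin 2)) x i j 1 1` (the `1 × 1` rectangle holonomy is the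
  plaquette holonomy).
* ★★ `torus_plaquetteReTrace_variance_su2` — for `wilsonMeasure (fundamentalRep (Fin 2)) β'`, `|β'| < 1/12`, every `L ≥ 2`, every plaquette `p`:
  `Var(Re Tr Q_p) ≤ 8/(1 − 12|β'|)` — Shen–Zhu–Zhu's single-plaquette input `Var(Re Tr Q_p) ≤ 4N/K_S` of Cor. 4.8 for `N = 2`, on the sharp window
  and uniformly in `L`.
* ★★ `torus_plaquetteReTrace_twoSided_su2` — `μ_{L,β'}{|Re Tr Q_p − ⟨Re Tr Q_p⟩| ≥ r} ≤ 2 exp(−(1 − 12|β'|) r²/16)`.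
* ★★ `torus_plaquetteReTrace_hasSubgaussianMGF_su2` — `HasSubgaussianMGF (Re Tr Q_p − ⟨Re Tr Q_p⟩) (8/(1 − 12|β'|))` (Mathlib's sense).

THEOREMS ONLY, no definition, no sorry.  HONEST FRAMING: STRONG coupling, fixed lattice, `SU(2)`, `d = 3`; the susceptibility SUM of Cor. 4.8
(translation/rotation invariance) is NOT proved here; nothing at weak coupling / in the continuum, nothing `K`-uniform along the route's scaling
(`UniformColdStartMixing`, 24809, ASIDE, not restated); no crux, rung or summit statement is proved; the Yang–Mills mass gap is NOT proved.

References: H. Shen, R. Zhu, X. Zhu, CMP 400 (2023) 805–851 = arXiv:2204.12737, Cor. 4.8 (proof: `Var(ReTr Q_p) ≤ 4N/K_S`) [ShenZhuZhu2022].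
-/

set_option autoImplicit false

noncomputable section

namespace Summit.QuantumFields.YangMills.Theorems.ColdStartUniversality

open MeasureTheory ProbabilityTheory Finset Filter Set Function
open scoped BigOperators NNReal ENNReal Topology Matrix Matrix.Norms.Frobenius ContDiff
open Literature.Probability.Process Literature.MathematicalPhysics.QuantumFieldTheory
open Literature.MathematicalPhysics.QuantumLattice (fundamentalRep fundamentalLatticeRep continuous_fundamentalRep fundamentalRep_apply)
open Literature.Barriers.QuantumFields (plaquetteReTrace)

/-! ## §1. `Re Tr Q_p = 2 · W_{1×1}` -/

/-- **The plaquette is the `1 × 1` rectangle**: `plaquetteReTrace (fundamentalRep (Fin 2)) p = 2 · wilsonLoop (fundamentalRep (Fin 2)) x i j 1 1` for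
`p = (x, (i, j))` (the `1 × 1` rectangular holonomy is the plaquette holonomy `U(x,i) U(x+eᵢ,j) U(x+eⱼ,i)⁻¹ U(x,j)⁻¹`). [folklore] -/
theorem plaquetteReTrace_eq_two_mul_wilsonLoop {L : ℕ} (p : Plaquette 3 L) (V : GaugeConfig 3 L (Matrix.specialUnitaryGroup (Fin 2) ℂ)) :
    plaquetteReTrace (fundamentalRep (Fin 2)) p V = 2 * wilsonLoop (fundamentalRep (Fin 2)) p.1 p.2.1.1 p.2.1.2 1 1 V := by
  have hrect : rectangleHolonomy V p.1 p.2.1.1 p.2.1.2 1 1 = plaquetteHolonomy V p.1 p.2.1.1 p.2.1.2 := by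
    simp [rectangleHolonomy, lineHolonomy, plaquetteHolonomy, Site.shift]
  unfold plaquetteReTrace wilsonLoop
  rw [hrect]
  push_cast
  ring

/-! ## §2. Variance, concentration and sub-Gaussian mgf of `Re Tr Q_p` on every torus, `|β'| < 1/12` -/

/-- ★★ **Shen–Zhu–Zhu's single-plaquette variance bound `Var(Re Tr Q_p) ≤ 4N/K` for `SU(2)`, sharp window, every volume**: for the periodic
`SU(2)` Wilson measure on `(ℤ/L)³` (`L ≥ 2`) at tree coupling `|β'| < 1/12` and every plaquette `p`,
`Var_{L,β'}(Re Tr Q_p) ≤ 8/(1 − 12|β'|)`.  The Yang–Mills mass gap is NOT proved. [cite: ShenZhuZhu2022, Corollary 4.8] -/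
theorem torus_plaquetteReTrace_variance_su2 {β' : ℝ} (hβ : |β'| < 1 / 12) (L : ℕ) [NeZero L] (hL : 1 < L) (p : Plaquette 3 L) :
    Var[plaquetteReTrace (fundamentalRep (Fin 2)) p; (wilsonMeasure (d := 3) (L := L) (fundamentalRep (Fin 2)) β')] ≤ 8 / (1 - 12 * |β'|) := by
  have hfun : plaquetteReTrace (fundamentalRep (Fin 2)) p =
      fun V : (GaugeConfig 3 L (Matrix.specialUnitaryGroup (Fin 2) ℂ)) => 2 * wilsonLoop (fundamentalRep (Fin 2)) p.1 p.2.1.1 p.2.1.2 1 1 V :=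
    funext fun V => plaquetteReTrace_eq_two_mul_wilsonLoop p V
  rw [hfun, variance_const_mul]
  have h := torus_wilsonLoop_rect_variance_su2 hβ L p.1 (ne_of_lt p.2.2) (le_refl 1) (le_refl 1) hL hL
  have hK : 0 < 1 - 12 * |β'| := by linarith
  calc (2 : ℝ) ^ 2 * Var[wilsonLoop (fundamentalRep (Fin 2)) p.1 p.2.1.1 p.2.1.2 1 1; (wilsonMeasure (d := 3) (L := L) (fundamentalRep (Fin 2)) β')]
      ≤ 2 ^ 2 * ((((1 : ℕ) : ℝ) + ((1 : ℕ) : ℝ)) / (1 - 12 * |β'|)) := mul_le_mul_of_nonneg_left h (by norm_num)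
    _ = 8 / (1 - 12 * |β'|) := by push_cast; ring

/-- ★★ **Gaussian concentration of the plaquette `Re Tr Q_p` on every torus, uniformly in the volume**: for the periodic `SU(2)` Wilson measure
on `(ℤ/L)³` (`L ≥ 2`) at tree coupling `|β'| < 1/12`, every plaquette `p` and `r ≥ 0`:
`μ_{L,β'}{|Re Tr Q_p − ⟨Re Tr Q_p⟩_{L,β'}| ≥ r} ≤ 2 exp(−(1 − 12|β'|) r²/16)`.  The Yang–Mills mass gap is NOT proved. [cite: ShenZhuZhu2022, Theorem 1.4] -/
theorem torus_plaquetteReTrace_twoSided_su2 {β' : ℝ} (hβ : |β'| < 1 / 12) (L : ℕ) [NeZero L] (hL : 1 < L) (p : Plaquette 3 L)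
    {r : ℝ} (hr : 0 ≤ r) :
    ((wilsonMeasure (d := 3) (L := L) (fundamentalRep (Fin 2)) β')).real {V | r ≤ |plaquetteReTrace (fundamentalRep (Fin 2)) p V -
        wilsonExpectation (d := 3) (L := L) (fundamentalRep (Fin 2)) β' (plaquetteReTrace (fundamentalRep (Fin 2)) p)|} ≤
      2 * Real.exp (-((1 - 12 * |β'|) * r ^ 2 / 16)) := by
  have hfun : plaquetteReTrace (fundamentalRep (Fin 2)) p =
      fun V : (GaugeConfig 3 L (Matrix.specialUnitaryGroup (Fin 2) ℂ)) => 2 * wilsonLoop (fundamentalRep (Fin 2)) p.1 p.2.1.1 p.2.1.2 1 1 V :=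
    funext fun V => plaquetteReTrace_eq_two_mul_wilsonLoop p V
  have hr2 : 0 ≤ r / 2 := by linarith
  have h := torus_wilsonLoop_rect_twoSided_su2 hβ L p.1 (ne_of_lt p.2.2) (le_refl 1) (le_refl 1) hL hL hr2
  have hE : wilsonExpectation (d := 3) (L := L) (fundamentalRep (Fin 2)) β' (plaquetteReTrace (fundamentalRep (Fin 2)) p) =
      2 * wilsonExpectation (d := 3) (L := L) (fundamentalRep (Fin 2)) β' (wilsonLoop (fundamentalRep (Fin 2)) p.1 p.2.1.1 p.2.1.2 1 1) := by
    unfold wilsonExpectation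
    rw [hfun, integral_const_mul]
  have hset : {V : (GaugeConfig 3 L (Matrix.specialUnitaryGroup (Fin 2) ℂ)) | r ≤ |plaquetteReTrace (fundamentalRep (Fin 2)) p V -
        wilsonExpectation (d := 3) (L := L) (fundamentalRep (Fin 2)) β' (plaquetteReTrace (fundamentalRep (Fin 2)) p)|} =
      {V | r / 2 ≤ |wilsonLoop (fundamentalRep (Fin 2)) p.1 p.2.1.1 p.2.1.2 1 1 V -
        wilsonExpectation (d := 3) (L := L) (fundamentalRep (Fin 2)) β' (wilsonLoop (fundamentalRep (Fin 2)) p.1 p.2.1.1 p.2.1.2 1 1)|} := by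
    ext V
    simp only [mem_setOf_eq, hE]
    rw [show plaquetteReTrace (fundamentalRep (Fin 2)) p V = 2 * wilsonLoop (fundamentalRep (Fin 2)) p.1 p.2.1.1 p.2.1.2 1 1 V from
      plaquetteReTrace_eq_two_mul_wilsonLoop p V, ← mul_sub, abs_mul, abs_of_pos (by norm_num : (0 : ℝ) < 2)]
    constructor <;> intro h' <;> linarith
  rw [hset]
  refine h.trans (le_of_eq ?_)
  congr 2
  push_cast
  ring

/-- ★★ **Sub-Gaussian mgf of the centred plaquette `Re Tr Q_p` on every torus** (Mathlib's `HasSubgaussianMGF`): variance proxy `8/(1 − 12|β'|)`, the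
same for every `L ≥ 2`, `|β'| < 1/12`.  The Yang–Mills mass gap is NOT proved. [cite: ShenZhuZhu2022, Theorem 1.4] -/
theorem torus_plaquetteReTrace_hasSubgaussianMGF_su2 {β' : ℝ} (hβ : |β'| < 1 / 12) (L : ℕ) [NeZero L] (hL : 1 < L) (p : Plaquette 3 L) :
    HasSubgaussianMGF (fun V => plaquetteReTrace (fundamentalRep (Fin 2)) p V -
        wilsonExpectation (d := 3) (L := L) (fundamentalRep (Fin 2)) β' (plaquetteReTrace (fundamentalRep (Fin 2)) p))
      ((8 : ℝ) / (1 - 12 * |β'|)).toNNReal (wilsonMeasure (d := 3) (L := L) (fundamentalRep (Fin 2)) β') := by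
  have hK : 0 < 1 - 12 * |β'| := by linarith
  have hfun : plaquetteReTrace (fundamentalRep (Fin 2)) p =
      fun V : (GaugeConfig 3 L (Matrix.specialUnitaryGroup (Fin 2) ℂ)) => 2 * wilsonLoop (fundamentalRep (Fin 2)) p.1 p.2.1.1 p.2.1.2 1 1 V :=
    funext fun V => plaquetteReTrace_eq_two_mul_wilsonLoop p V
  have hE : wilsonExpectation (d := 3) (L := L) (fundamentalRep (Fin 2)) β' (plaquetteReTrace (fundamentalRep (Fin 2)) p) =
      2 * wilsonExpectation (d := 3) (L := L) (fundamentalRep (Fin 2)) β' (wilsonLoop (fundamentalRep (Fin 2)) p.1 p.2.1.1 p.2.1.2 1 1) := by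
    unfold wilsonExpectation
    rw [hfun, integral_const_mul]
  have h := (torus_wilsonLoop_rect_hasSubgaussianMGF_su2 hβ L p.1 (ne_of_lt p.2.2) (le_refl 1) (le_refl 1) hL hL).const_mul 2
  have hfun2 : (fun V : (GaugeConfig 3 L (Matrix.specialUnitaryGroup (Fin 2) ℂ)) => plaquetteReTrace (fundamentalRep (Fin 2)) p V -
        wilsonExpectation (d := 3) (L := L) (fundamentalRep (Fin 2)) β' (plaquetteReTrace (fundamentalRep (Fin 2)) p)) =
      fun V => 2 * (wilsonLoop (fundamentalRep (Fin 2)) p.1 p.2.1.1 p.2.1.2 1 1 V -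
        wilsonExpectation (d := 3) (L := L) (fundamentalRep (Fin 2)) β' (wilsonLoop (fundamentalRep (Fin 2)) p.1 p.2.1.1 p.2.1.2 1 1)) := by
    funext V; rw [hE, plaquetteReTrace_eq_two_mul_wilsonLoop p V]; ring
  rw [hfun2]
  convert h using 2
  apply NNReal.eq
  rw [NNReal.coe_mul, Real.coe_toNNReal _ (by positivity), Real.coe_toNNReal _ (by positivity)]
  show (8 : ℝ) / (1 - 12 * |β'|) = (2 : ℝ) ^ 2 * ((((1 : ℕ) : ℝ) + ((1 : ℕ) : ℝ)) / (1 - 12 * |β'|))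
  push_cast
  ring

end Summit.QuantumFields.YangMills.Theorems.ColdStartUniversality

end
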